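/-
Copyright (c) 2026 the pub-hodgecm-mathlib formalisation cell (harness21).  Prover seat hodgecm-mathlib-LH4-p11 (g7), req620 Track A «(D-RAM) FOUR-FRAME» squad, helper lane
on h413 = stmt-HodgeConjecture-24833 (count-neutral).  STAGE-1b brick (c3) of the seat's KNOCK 2026-09-04T08:24Z (claimed 08:50Z): the LITERAL-TO-FRAME glue and the
WINDOW for the socket ★ p858674 ∘ brick (c2).  2026-09-04.
-/
import Summits.HodgeConjecture.HodgeConjecture.Theorems.F0P3cDyRamProfileCountCentralRescaling   -- ★ (c2) (this seat): `transvPlusFixCount_eq_of_coe_eq_smul`, `transvMinusFixCount_…`, `regFixCount_…`; brings ★ U2G DEFS `cntStar`, ★ №3 `dOfPlace`, `mstarFn`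
import Literature.NumberTheory.Automorphic.UnitaryThreeFourFrameFixedCosetDictionary              -- ★ (B-p08 (g41)): `fixedVertexCount_eq_of_coe_eq_smul`, `v_eq_one_of_mul_map_eq_one`
import Literature.NumberTheory.Rogawski1990.FinExplicitTransferFactor                           -- ★ `finGammaTwo` (`γ₂` of `γ_H` at `v`)
import Literature.NumberTheory.Rogawski1990.LeviNearOneTwoDeep                                  -- ★ `isOpen_setOf_valued_le_valued`
import HarnessLib

/-!
# Crux `H413`, line LH4 «(D-RAM) FOUR-FRAME» — LITERAL-TO-FRAME GLUE FOR THE PIECE CENSUS: on the window `|γ₂(γ_H)_w − 1| ≤ |ϖ|^{m*}` (a neighbourhood of `1 ∈ H_v`)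
# every count selector `cntStar j` takes the same value at the (D-CΔ)-S literal `ι_w t_b = z·Γ_b` as at the FRAME `Γ_b` (`z = γ₂(γ_H)_w ∈ E¹`), hence so do the
# κ-signed and the stable four-frame census sums of ★ `pieceRowsWild_of_signedCensus`'s H-side row

Cell `hodgecm-mathlib` (D-0151), FLOOR 0, crux item H413 = `stmt-HodgeConjecture-24833`, route of record `HCCMUnconditional`; squad F0∕P3c∕LH4 (req618∕req620); helper lane
`--supports stmt-HodgeConjecture-24833 --as helper` (count-neutral).  THEOREMS ONLY (no `def`, no instance, no notation, no `sorry`, default heartbeats).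

WHY (STAGE-1b; LEAD T19-24 scoping lane).  The socket ★ p858674 `pieceRowsWild_of_signedCensus` asks the H-side producer of row (1) to realise, for `G`-regular `γ_H` near
`1` and every literal package `(f, a, b, z, n, k, Γ, t_b, i, B)` of (D-CΔ)-S, the value `Δ‴(γ_H, t_{b₀})·νG₃(K)·Σ_b κ_i(b)·cnt_j(ι_w t_b)`, where `ι_w t_b = z·Γ_b` as matrices
and `z = finGammaTwo L v γ_H w` is a norm-one scalar (`z·σ_w z = 1`).  The census LAWS one can hope to type (like U3's (S)∕(K-ABS)∕(K-SGN)) live on the FRAMES `Γ_b =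
frameElt σ_w f b (a²) (b²)`.  Brick (c2) ★ `F0P3cDyRamProfileCountCentralRescaling` shows the profile counts are blind to `Γ ↦ z·Γ` once `|z| = 1` and `|z − 1| ≤ |ϖ|^m`
(`m` = the level the profile is read at); the anchor count is blind outright (★ `fixedVertexCount_eq_of_coe_eq_smul`).  THIS FILE packages that for the selectors of
record and supplies the window: §1 `|finGammaTwo L v γ_H w − 1| ≤ |c|` holds on a neighbourhood of `1 ∈ H_v` for every `c ≠ 0` (continuity of `γ_H ↦ (γ_H.2)₀₀` at `w`;
★ `isOpen_setOf_valued_le_valued`) — the producer intersects it (with `c := ϖ^{m*}`) into the row's `V`; §2 on that window `cntStar j … (T') = cntStar j … (T)` whenever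
`(T' : Matrix) = z • T` (`j = 0` anchor ∕ `1, 2` the labelled near-transvection profiles at `(ℓ₀, m*) = (d % 2, mstarFn)` — needs `1 ≤ dOfPlace`, true at every ramified place
(★ `dOfPlace_eq_of_isRamifiedQuadraticDatum`) and taken as a hypothesis ∕ `3` regular); §3 the four-literal sums: `Σ_b κ_i(b)·cnt_j(ι_w t_b) = Σ_b κ_i(b)·cnt_j(Γ_b)` and
`Σ_b cnt_j(ι_w t_b) = Σ_b cnt_j(Γ_b)` in the binder shape of the socket's row (1) (`htb : ι_w (t_b) = z • Γ_b`).

WHAT IS PROVED.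
* §1 `exists_nhds_one_v_finGammaTwo_sub_one_le (hc : c ≠ 0)` — the window is a neighbourhood of `1`.
* §2 `cntStar_eq_of_coe_eq_smul` — all four selectors at `z·T` equal those at `T` (`z·σ_w z = 1`, `|z − 1| ≤ |ϖ|^{mstarFn}`, `1 ≤ dOfPlace`).
* §3 `sum_kappaChar_mul_cntStar_literal_eq`, `sum_cntStar_literal_eq` — the κ-signed ∕ stable census over the four (D-CΔ)-S literals equals that over the four frames.
HONEST LABEL.  Count-neutral (`--supports`): bookkeeping over ★ DEFS and ★ (c2); pays no registered stub, touches no `Lines/` module, states no census law; tier-0 rows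
T₊∕T₋∕reg stay OPEN; `HC_CM` is proved only modulo the 7 printed citations (2 remaining named inputs: hLiu418 = `stmt-HodgeConjecture-24832`, h413 =
`stmt-HodgeConjecture-24833`) until rung 0 closes.

## References
* [Rogawski1990] J. D. Rogawski, *Automorphic Representations of Unitary Groups in Three Variables*, Ann. of Math. Stud. 123 (1990), §4.9 Prop. 4.9.1 (a)(b) p. 55, Lemma 4.9.3 p. 56.
* [Kottwitz1986BaseChangeUnits] R. E. Kottwitz, *Base change for unit elements of Hecke algebras*, Compositio Math. 60 (1986), §1 pp. 240–241.
* [LanglandsShelstad1987] R. P. Langlands, D. Shelstad, *On the definition of transfer factors*, Math. Ann. 278 (1987), §1.3, §3.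
* [BernsteinZelevinsky1976] I. N. Bernstein, A. V. Zelevinsky, *Representations of the group GL(n, F) where F is a non-archimedean local field*, Russian Math. Surveys 31 (1976), §1.1 (l-spaces; open compact neighbourhoods).
-/

set_option autoImplicit false

noncomputable section

namespace Summit.HodgeConjecture.HodgeConjecture.Cruxes.H413.F0P3cDyRamSignedCensusLiteralToFrame

open MeasureTheory Measure NumberField IsDedekindDomain Topology Filter
open Literature.NumberTheory.Automorphic Literature.NumberTheory.Automorphic.UnitaryGroup Literature.NumberTheory.Automorphic.IntegralReduction
open Literature.NumberTheory.Automorphic.UnitaryLatticeTree Literature.NumberTheory.Automorphic.HermitianLattice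
open Literature.NumberTheory.Rogawski1990 Literature.NumberTheory.GaloisRepresentations
open Literature.NumberTheory.Automorphic.UnitaryThreeFourFrame
open scoped Matrix MatrixGroups Classical ValuativeRel WithZero
open Summit.HodgeConjecture.HodgeConjecture.Cruxes.H413.F0P3cDyRamFourFramePieces
open Summit.HodgeConjecture.HodgeConjecture.Cruxes.H413.F0P3cDyRamFourFrameCensusDefs
open Summit.HodgeConjecture.HodgeConjecture.Cruxes.H413.F0P3cDyRamProfileCountCentralRescaling

/-! ## §1  The window `|γ₂(γ_H)_w − 1| ≤ |c|` is a neighbourhood of `1 ∈ H_v` -/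

/-- **THE WINDOW.**  For every `c ≠ 0` in `L_w` there is a neighbourhood `V` of `1 ∈ H_v = U(Φ₂)(L⁺_v) × U(Φ₁)(L⁺_v)` on which `|finGammaTwo L v γ_H w − 1| ≤ |c|`
(continuity of `γ_H ↦ (γ_H.2)₀₀` composed with evaluation at `w`; the closed ball is open, ★ `isOpen_setOf_valued_le_valued`). [cite: Rogawski1990, §4.9 p. 55]
[cite: BernsteinZelevinsky1976, §1.1] -/
theorem exists_nhds_one_v_finGammaTwo_sub_one_le (L : Type) [Field L] [NumberField L] [IsCMField L]
    {v : HeightOneSpectrum (𝓞 ↥(maximalRealSubfield L))} (w : UnitaryGroup.PlacesOver L v) {c : w.1.adicCompletion L} (hc : c ≠ 0) :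
    ∃ V ∈ 𝓝 (1 : ((UnitaryGroup.cmDatum L 2 (Matrix.of fun i j : Fin 2 => if i.val + j.val + 1 = 2 then (1 : L) else 0)).Local v × (UnitaryGroup.cmDatum L 1 (Matrix.of fun i j : Fin 1 => if i.val + j.val + 1 = 1 then (1 : L) else 0)).Local v)), ∀ γH ∈ V, Valued.v (finGammaTwo L v γH w - 1) ≤ Valued.v c := by
  -- `γ_H ↦ (γ_H.2)₀₀` evaluated at `w` is continuous (`finGammaTwo` is that entry by definition)
  have hcont : Continuous fun γH : ((UnitaryGroup.cmDatum L 2 (Matrix.of fun i j : Fin 2 => if i.val + j.val + 1 = 2 then (1 : L) else 0)).Local v × (UnitaryGroup.cmDatum L 1 (Matrix.of fun i j : Fin 1 => if i.val + j.val + 1 = 1 then (1 : L) else 0)).Local v) =>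
      ((γH.2.val.val : Matrix (Fin 1) (Fin 1) (UnitaryGroup.LocalRing L v)) 0 0) w :=
    (continuous_apply w).comp ((Units.continuous_val.comp (continuous_subtype_val.comp continuous_snd)).matrix_elem 0 0)
  have hopen : IsOpen ((fun γH : ((UnitaryGroup.cmDatum L 2 (Matrix.of fun i j : Fin 2 => if i.val + j.val + 1 = 2 then (1 : L) else 0)).Local v × (UnitaryGroup.cmDatum L 1 (Matrix.of fun i j : Fin 1 => if i.val + j.val + 1 = 1 then (1 : L) else 0)).Local v) =>
      ((γH.2.val.val : Matrix (Fin 1) (Fin 1) (UnitaryGroup.LocalRing L v)) 0 0) w - 1) ⁻¹'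
        {x : w.1.adicCompletion L | Valued.v x ≤ Valued.v c}) :=
    (isOpen_setOf_valued_le_valued hc).preimage (hcont.sub continuous_const)
  refine ⟨_, hopen.mem_nhds ?_, fun γH hγ => ?_⟩
  · have h1 : ((((1 : ((UnitaryGroup.cmDatum L 2 (Matrix.of fun i j : Fin 2 => if i.val + j.val + 1 = 2 then (1 : L) else 0)).Local v × (UnitaryGroup.cmDatum L 1 (Matrix.of fun i j : Fin 1 => if i.val + j.val + 1 = 1 then (1 : L) else 0)).Local v)).2).val.val : Matrix (Fin 1) (Fin 1) (UnitaryGroup.LocalRing L v)) 0 0) w = 1 := rfl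
    simp only [Set.mem_preimage, Set.mem_setOf_eq, h1, sub_self, map_zero]
    exact zero_le
  · simpa only [Set.mem_preimage, Set.mem_setOf_eq, finGammaTwo] using hγ

/-! ## §2  The four count selectors at `z·T` versus `T` -/

/-- **`cntStar j` AT A CENTRAL RESCALING.**  At a `σ`-stable place `w`, for `z ∈ L_w` with `z·σ_w z = 1` and `|z − 1| ≤ |ϖ|^{mstarFn L v w}`, `1 ≤ dOfPlace L v w`, and
`(T' : Matrix) = z • T`: `cntStar j L v w hw ϖ T' = cntStar j L v w hw ϖ T` for `j = 0, 1, 2, 3` (`j = 0`: ★ `fixedVertexCount_eq_of_coe_eq_smul`; `j = 1, 2, 3`: ★ (c2) at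
`(ℓ₀, m*) = (dOfPlace % 2, mstarFn)`, `ℓ₀ + 1 ≤ m*` from `1 ≤ dOfPlace`). [cite: Kottwitz1986BaseChangeUnits, §1 pp. 240–241] [cite: Rogawski1990, §4.9 Prop. 4.9.1 (b) p. 55] -/
theorem cntStar_eq_of_coe_eq_smul (L : Type) [Field L] [NumberField L] [IsCMField L]
    {v : HeightOneSpectrum (𝓞 ↥(maximalRealSubfield L))} (w : UnitaryGroup.PlacesOver L v) (hw : IsCMField.complexConj L • w.1 = w.1)
    (ϖ : w.1.adicCompletion L) (hϖ : Valued.v ϖ = WithZero.exp (-1 : ℤ)) (hd : 1 ≤ dOfPlace L v w)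
    {z : w.1.adicCompletion L} (hz : z * (galAdicCompletionMap (L := L) (IsCMField.complexConj L) hw) z = 1) (hzm : Valued.v (z - 1) ≤ Valued.v ϖ ^ mstarFn L v w)
    {T T' : GL (Fin 3) (w.1.adicCompletion L)} (hT' : (T' : Matrix (Fin 3) (Fin 3) (w.1.adicCompletion L)) = z • (T : Matrix (Fin 3) (Fin 3) (w.1.adicCompletion L)))
    (j : Fin 4) : cntStar j L v w hw ϖ T' = cntStar j L v w hw ϖ T := by
  have hvσ : ∀ a, Valued.v ((galAdicCompletionMap (L := L) (IsCMField.complexConj L) hw) a) = Valued.v a := fun a => valued_galAdicCompletionMap (L := L) (IsCMField.complexConj L) hw a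
  have hz1 : Valued.v z = 1 := v_eq_one_of_mul_map_eq_one hvσ hz
  have hϖ0 : ϖ ≠ 0 := fun h0 => by rw [h0, map_zero] at hϖ; exact WithZero.coe_ne_zero hϖ.symm
  have hϖ1 : Valued.v ϖ ≤ 1 := by rw [hϖ, ← WithZero.exp_zero]; exact WithZero.exp_le_exp.2 (by norm_num)
  have hℓm : dOfPlace L v w % 2 + 1 ≤ mstarFn L v w := by unfold mstarFn mstarOfRecord; omega
  fin_cases j
  · exact fixedVertexCount_eq_of_coe_eq_smul _ ϖ 0 hz1 hT'
  · exact transvPlusFixCount_eq_of_coe_eq_smul hvσ hϖ0 hϖ1 hz1 _ hℓm hzm hT'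
  · exact transvMinusFixCount_eq_of_coe_eq_smul hvσ hϖ0 hϖ1 hz1 _ hℓm hzm hT'
  · exact regFixCount_eq_of_coe_eq_smul _ hϖ0 hϖ1 hz1 hzm hT'

/-! ## §3  The four-literal census sums of the socket's row (1) equal the four-FRAME sums -/

/-- **κ-SIGNED CENSUS: LITERALS = FRAMES.**  In the binder shape of ★ `pieceRowsWild_of_signedCensus`'s H-side row (1) — literals `t_b ∈ G_v` with place matrices
`ι_w t_b = z • Γ_b` — on the window `|z − 1| ≤ |ϖ|^{mstarFn L v w}` (`z·σ_w z = 1`, `1 ≤ dOfPlace`):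
`Σ_b κ_i(b)·cntStar j (ι_w t_b) = Σ_b κ_i(b)·cntStar j (Γ_b)`. [cite: Rogawski1990, §4.9 Prop. 4.9.1 (a)(b) p. 55] [cite: LanglandsShelstad1987, §1.3] -/
theorem sum_kappaChar_mul_cntStar_literal_eq (L : Type) [Field L] [NumberField L] [IsCMField L]
    {v : HeightOneSpectrum (𝓞 ↥(maximalRealSubfield L))} (w : UnitaryGroup.PlacesOver L v) (hw : IsCMField.complexConj L • w.1 = w.1)
    (ϖ : w.1.adicCompletion L) (hϖ : Valued.v ϖ = WithZero.exp (-1 : ℤ)) (hd : 1 ≤ dOfPlace L v w)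
    {z : w.1.adicCompletion L} (hz : z * (galAdicCompletionMap (L := L) (IsCMField.complexConj L) hw) z = 1) (hzm : Valued.v (z - 1) ≤ Valued.v ϖ ^ mstarFn L v w)
    (Γ : Fin 4 → GL (Fin 3) (w.1.adicCompletion L)) (tb : Fin 4 → ((UnitaryGroup.cmDatum L 3 (Matrix.of fun i j : Fin 3 => if i.val + j.val + 1 = 3 then (1 : L) else 0)).Local v))
    (htb : ∀ b', ((((localNonsplitEquiv (IsCMField.complexConj L) (Matrix.of fun i j : Fin 3 => if i.val + j.val + 1 = 3 then (1 : L) else 0) (IsCMField.complexConj_ne_one L) w hw (tb b') :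
              ↥(unitaryGroupOfForm (galAdicCompletionMap (L := L) (IsCMField.complexConj L) hw) (placeForm (Matrix.of fun i j : Fin 3 => if i.val + j.val + 1 = 3 then (1 : L) else 0) w.1))) : GL (Fin 3) (w.1.adicCompletion L)) : Matrix (Fin 3) (Fin 3) (w.1.adicCompletion L))) = z • (Γ b' : Matrix (Fin 3) (Fin 3) (w.1.adicCompletion L)))
    (i : Fin 3) (j : Fin 4) :
    ∑ b' : Fin 4, (kappaChar i b' : ℂ) * (cntStar j L v w hw ϖ ((localNonsplitEquiv (IsCMField.complexConj L) (Matrix.of fun i j : Fin 3 => if i.val + j.val + 1 = 3 then (1 : L) else 0) (IsCMField.complexConj_ne_one L) w hw (tb b') :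
              ↥(unitaryGroupOfForm (galAdicCompletionMap (L := L) (IsCMField.complexConj L) hw) (placeForm (Matrix.of fun i j : Fin 3 => if i.val + j.val + 1 = 3 then (1 : L) else 0) w.1))) : GL (Fin 3) (w.1.adicCompletion L)) : ℂ) =
      ∑ b' : Fin 4, (kappaChar i b' : ℂ) * (cntStar j L v w hw ϖ (Γ b') : ℂ) :=
  Finset.sum_congr rfl fun b' _ => by rw [cntStar_eq_of_coe_eq_smul L w hw ϖ hϖ hd hz hzm (htb b') j]

/-- **STABLE CENSUS: LITERALS = FRAMES** (same window): `Σ_b cntStar j (ι_w t_b) = Σ_b cntStar j (Γ_b)`. [cite: Rogawski1990, §4.9 Prop. 4.9.1 (a)(b) p. 55]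
[cite: Kottwitz1986BaseChangeUnits, §1 pp. 240–241] -/
theorem sum_cntStar_literal_eq (L : Type) [Field L] [NumberField L] [IsCMField L]
    {v : HeightOneSpectrum (𝓞 ↥(maximalRealSubfield L))} (w : UnitaryGroup.PlacesOver L v) (hw : IsCMField.complexConj L • w.1 = w.1)
    (ϖ : w.1.adicCompletion L) (hϖ : Valued.v ϖ = WithZero.exp (-1 : ℤ)) (hd : 1 ≤ dOfPlace L v w)
    {z : w.1.adicCompletion L} (hz : z * (galAdicCompletionMap (L := L) (IsCMField.complexConj L) hw) z = 1) (hzm : Valued.v (z - 1) ≤ Valued.v ϖ ^ mstarFn L v w)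
    (Γ : Fin 4 → GL (Fin 3) (w.1.adicCompletion L)) (tb : Fin 4 → ((UnitaryGroup.cmDatum L 3 (Matrix.of fun i j : Fin 3 => if i.val + j.val + 1 = 3 then (1 : L) else 0)).Local v))
    (htb : ∀ b', ((((localNonsplitEquiv (IsCMField.complexConj L) (Matrix.of fun i j : Fin 3 => if i.val + j.val + 1 = 3 then (1 : L) else 0) (IsCMField.complexConj_ne_one L) w hw (tb b') :
              ↥(unitaryGroupOfForm (galAdicCompletionMap (L := L) (IsCMField.complexConj L) hw) (placeForm (Matrix.of fun i j : Fin 3 => if i.val + j.val + 1 = 3 then (1 : L) else 0) w.1))) : GL (Fin 3) (w.1.adicCompletion L)) : Matrix (Fin 3) (Fin 3) (w.1.adicCompletion L))) = z • (Γ b' : Matrix (Fin 3) (Fin 3) (w.1.adicCompletion L)))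
    (j : Fin 4) :
    ∑ b' : Fin 4, (cntStar j L v w hw ϖ ((localNonsplitEquiv (IsCMField.complexConj L) (Matrix.of fun i j : Fin 3 => if i.val + j.val + 1 = 3 then (1 : L) else 0) (IsCMField.complexConj_ne_one L) w hw (tb b') :
              ↥(unitaryGroupOfForm (galAdicCompletionMap (L := L) (IsCMField.complexConj L) hw) (placeForm (Matrix.of fun i j : Fin 3 => if i.val + j.val + 1 = 3 then (1 : L) else 0) w.1))) : GL (Fin 3) (w.1.adicCompletion L)) : ℕ) = ∑ b' : Fin 4, cntStar j L v w hw ϖ (Γ b') :=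
  Finset.sum_congr rfl fun b' _ => cntStar_eq_of_coe_eq_smul L w hw ϖ hϖ hd hz hzm (htb b') j

end Summit.HodgeConjecture.HodgeConjecture.Cruxes.H413.F0P3cDyRamSignedCensusLiteralToFrame

end
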